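import Summits.BirchSwinnertonDyer.Rank1Residual.X11b.IntSeriesValueRigidity
import Mathlib.RingTheory.AdicCompletion.Basic
import HarnessLib

/-!
# X11b · S29 K2b-1: `𝓞_{ℂ_p}` is `(ϖ)`-adically complete for every `ϖ` with `0 < ‖ϖ‖ < 1`

HONEST FRAMING (cell `b2b-bsdres`, run/shared/lean/b2b/bsd-rank1-residual/, verbatim in every
file): the goal of the cell is to DELETE the COMBINATION-SHAPED residual classes of the
Birch–Swinnerton-Dyer formula for ALL analytic-rank `≤ 1` elliptic curves over `ℚ` — assembled
STRICTLY from published theorems — so that the rank-`≤ 1` remainder becomes exactly the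
CONSTRUCTION-SHAPED classes, which are TYPED, NOT attempted. This is not "finishing BSD". Team
`x11b3` = N8/O2 (X11b at `p = 3`): research routes; nothing booked; no label change; O2 OPEN; the
node of record `Three.HsiehDescentAt₃` is UNCHANGED by this file (S29 RE-EXPRESSES (t) ⟸ (VR);
lead GEN 8 R9-8 / R9-11). THEOREMS ONLY (no definition, no named fact, no `sorry`, no instance).

PROVENANCE: S29 K2b (exponent integrality), input (α1) of the Weierstrass road
(`HOME/b2b-bsdres-x11b3-p3/gen7/K2-INTERFACE-DRAFT.md` ADDENDUM 2; lead GEN 8 R9-11: "check for an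
existing `IsAdicComplete`/`PadicComplexInt` instance before writing (α1)" — none exists in Mathlib
or the tree for the NON-noetherian valuation ring `𝓞_{ℂ_p}`, whose maximal ideal satisfies
`𝔪² = 𝔪`; the adic topology that works is the `(ϖ)`-adic one for any `ϖ` of valuation strictly
between `0` and `1`, and it coincides with the norm topology). With this, the tree's Weierstrass
preparation `Literature.RingTheory.HenselLemma.exists_isWeierstrassFactorizationAt` (stated for ANY
ideal `I` with `[IsAdicComplete I A]`) applies to `𝓞_{ℂ_p}⟦T⟧`.

## What is proved (seat `b2b-bsdres-x11b3-p3` GEN 7; every prime `p`)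
* `mem_span_singleton_pow_iff_norm_le` — for `ϖ ≠ 0` in `𝓞_{ℂ_p}`: `x ∈ (ϖ)ⁿ ⟺ ‖x‖ ≤ ‖ϖ‖ⁿ`;
* **`isAdicComplete_span_singleton`** — `0 < ‖ϖ‖ < 1 ⟹ IsAdicComplete (Ideal.span {ϖ}) 𝓞_ℂ_[p]`
  (Hausdorff: `‖ϖ‖ⁿ → 0`; precomplete: an adically Cauchy sequence is norm-Cauchy in the complete
  field `ℂ_p`, its limit lies in the closed unit ball, and the ultrametric tail bound
  `‖f n − L‖ ≤ ‖ϖ‖ⁿ` is the adic convergence). A THEOREM, not an instance (consumers `haveI`).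

References: [Cassels1986] Ch. 4; Bourbaki, *Alg. comm.* VI (valuation rings of complete fields).
-/

noncomputable section

open scoped Classical Topology
open Filter Literature.NumberTheory.EllipticCurves

namespace Summit.BirchSwinnertonDyer.Rank1Residual.X11b

variable {p : ℕ} [Fact p.Prime]

/-- In the valuation ring `𝓞_{ℂ_p}`: `ϖⁿ ∣ x ⟺ ‖x‖ ≤ ‖ϖ‖ⁿ` (`ϖ ≠ 0`), i.e. membership in the
principal ideal `(ϖ)ⁿ = (ϖⁿ)` is a norm condition. [folklore] -/
theorem mem_span_singleton_pow_iff_norm_le {ϖ : 𝓞_ℂ_[p]} (hϖ : ϖ ≠ 0) (n : ℕ) (x : 𝓞_ℂ_[p]) :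
    x ∈ (Ideal.span {ϖ} : Ideal 𝓞_ℂ_[p]) ^ n ↔ ‖(x : ℂ_[p])‖ ≤ ‖(ϖ : ℂ_[p])‖ ^ n := by
  rw [Ideal.span_singleton_pow, Ideal.mem_span_singleton]
  have hϖC : (ϖ : ℂ_[p]) ≠ 0 := fun h => hϖ (by exact_mod_cast h)
  constructor
  · rintro ⟨y, rfl⟩
    rw [MulMemClass.coe_mul, SubmonoidClass.coe_pow, norm_mul, norm_pow]
    exact mul_le_of_le_one_right (pow_nonneg (norm_nonneg _) _)
      (R1.norm_coe_padicComplexInt_le_one p y)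
  · intro hle
    -- the quotient `x / ϖⁿ` lies in the unit ball
    have hpow : ((ϖ : ℂ_[p]) ^ n) ≠ 0 := pow_ne_zero _ hϖC
    have hq : ‖(x : ℂ_[p]) / (ϖ : ℂ_[p]) ^ n‖ ≤ 1 := by
      rw [norm_div, norm_pow]
      exact div_le_one_of_le₀ hle (pow_nonneg (norm_nonneg _) _)
    refine ⟨⟨(x : ℂ_[p]) / (ϖ : ℂ_[p]) ^ n,
      Literature.NumberTheory.LFunctions.Dwork.mem_unitBall.mpr hq⟩, ?_⟩
    apply Subtype.ext
    rw [MulMemClass.coe_mul, SubmonoidClass.coe_pow]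
    change (x : ℂ_[p]) = (ϖ : ℂ_[p]) ^ n * ((x : ℂ_[p]) / (ϖ : ℂ_[p]) ^ n)
    rw [mul_div_cancel₀ _ hpow]

/-- **`𝓞_{ℂ_p}` is `(ϖ)`-adically complete** for every `ϖ ∈ 𝓞_{ℂ_p}` with `0 < ‖ϖ‖ < 1`: the
`(ϖ)`-adic topology is the norm topology, `ℂ_p` is complete and the unit ball is closed. (Stated as
a theorem; use `haveI := isAdicComplete_span_singleton hϖ h1`.) [folklore] -/
theorem isAdicComplete_span_singleton {ϖ : 𝓞_ℂ_[p]} (hϖ : ϖ ≠ 0) (h1 : ‖(ϖ : ℂ_[p])‖ < 1) :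
    IsAdicComplete (Ideal.span {ϖ} : Ideal 𝓞_ℂ_[p]) 𝓞_ℂ_[p] := by
  set I : Ideal 𝓞_ℂ_[p] := Ideal.span {ϖ} with hI
  set r : ℝ := ‖(ϖ : ℂ_[p])‖ with hr
  have hr0 : 0 ≤ r := norm_nonneg _
  -- dictionary: `x ≡ y [SMOD Iⁿ • ⊤]` iff `‖x - y‖ ≤ rⁿ`
  have hmod : ∀ (n : ℕ) (x y : 𝓞_ℂ_[p]),
      x ≡ y [SMOD (I ^ n • ⊤ : Submodule 𝓞_ℂ_[p] 𝓞_ℂ_[p])] ↔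
        ‖((x - y : 𝓞_ℂ_[p]) : ℂ_[p])‖ ≤ r ^ n := by
    intro n x y
    rw [SModEq.sub_mem, smul_eq_mul, Ideal.mul_top, hI, mem_span_singleton_pow_iff_norm_le hϖ]
  have hH : IsHausdorff I 𝓞_ℂ_[p] := by
    refine ⟨fun x hx => ?_⟩
    have hxn : ∀ n : ℕ, ‖(x : ℂ_[p])‖ ≤ r ^ n := fun n => by
      have := (hmod n x 0).mp (hx n)
      simpa using this
    have h0 : ‖(x : ℂ_[p])‖ ≤ 0 :=
      ge_of_tendsto (tendsto_pow_atTop_nhds_zero_of_lt_one hr0 h1) (Eventually.of_forall hxn)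
    exact_mod_cast (norm_le_zero_iff.mp h0)
  have hP : IsPrecomplete I 𝓞_ℂ_[p] := by
    refine ⟨fun f hf => ?_⟩
    have hdist : ∀ {m n : ℕ}, m ≤ n → ‖((f m : 𝓞_ℂ_[p]) : ℂ_[p]) - (f n : ℂ_[p])‖ ≤ r ^ m := by
      intro m n hmn
      have := (hmod m (f m) (f n)).mp (hf hmn)
      simpa using this
    have hcau : CauchySeq fun n => ((f n : 𝓞_ℂ_[p]) : ℂ_[p]) := by
      refine Metric.cauchySeq_iff'.mpr fun ε hε => ?_
      obtain ⟨N, hN⟩ := (tendsto_pow_atTop_nhds_zero_of_lt_one hr0 h1).eventually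
        (gt_mem_nhds hε) |>.exists_forall_of_atTop.imp fun N h => h
      refine ⟨N, fun n hn => ?_⟩
      rw [dist_eq_norm, ← norm_neg, neg_sub]
      exact (hdist hn).trans_lt (hN N le_rfl)
    obtain ⟨L, hL⟩ := cauchySeq_tendsto_of_complete hcau
    -- the limit lies in the unit ball
    have hL1 : ‖L‖ ≤ 1 :=
      le_of_tendsto' (hL.norm) fun n => R1.norm_coe_padicComplexInt_le_one p (f n)
    refine ⟨⟨L, Literature.NumberTheory.LFunctions.Dwork.mem_unitBall.mpr hL1⟩, fun n => ?_⟩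
    rw [hmod]
    -- ultrametric tail bound `‖f n - L‖ ≤ rⁿ`
    have htail : Tendsto (fun k => ‖((f n : 𝓞_ℂ_[p]) : ℂ_[p]) - (f k : ℂ_[p])‖) atTop
        (𝓝 ‖((f n : 𝓞_ℂ_[p]) : ℂ_[p]) - L‖) := (tendsto_const_nhds.sub hL).norm
    have hev : ∀ᶠ k in atTop, ‖((f n : 𝓞_ℂ_[p]) : ℂ_[p]) - (f k : ℂ_[p])‖ ≤ r ^ n :=
      (eventually_ge_atTop n).mono fun k hk => hdist hk
    have := le_of_tendsto htail hev
    simpa using this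
  exact ⟨⟩

end Summit.BirchSwinnertonDyer.Rank1Residual.X11b

end
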